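import Summits.CriticalPhenomena.PercolationContinuityZ3.Theorems.PercNearOneGluingNoHeavyQuantDIBStar
import Summits.CriticalPhenomena.PercolationContinuityZ3.Theorems.PercNearOneGluingNoHeavyQuantIndepBlobGapPairs
import HarnessLib

/-!
# QUANT lane R8, FAR on general trees — the MATCHING ROW of the gap calculus as a TERM rule for the conditional root row R3
# (`Quant.RootDec.rtail_ge_of_decCert`, `…QuantDIBStar`)

builds on p205010 (kernel theorem, internal audit signed; external expert review pending)

Support file (`--supports stmt-CriticalPhenomena-4575`), QUANT lane lead (gen 16), rung R8 of
`run/shared/lean/prim/quant/LADDER.md`; memo `run/shared/lean/prim/quant/prim-quant-lead-g16/LEAD-NOTES-G16.md` N31.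
Theorems only, no definitions, no sorries, standard axioms.  Companion of `…QuantRootDecGapCert` (γ‴, companion cloud, one light).

* `Quant.RootDec.term_ge_of_matched_companions` — gates in `[0,1]`, floor `1/2 ≤ x < 1`; every blob of a finset `L` (any gates) matched
  by an injective companion map `c` to its own heavy blob `c ℓ ∉ L` of at least its size with `x(1 − g (c ℓ))(1 − g ℓ) ≤ (1 − x)·g (c ℓ)·g ℓ`
  (`odds·odds ≥ odds(x)`); every blob outside `L` heavy; sizes totalling `≥ 2(j − s) + 1` ⟹ `x ≤ TERM[s, a, g, j]`
  (`IndepBlob.tail_ge_of_matched_companions`, `…QuantIndepBlobGapPairs`, through `RootDec.term_shift`).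

[this work]; the gluing rows served: [cite: KozmaNitzan2024, Conjecture 3 (p. 15)].
-/

namespace Summit.CriticalPhenomena.PercolationContinuityZ3.Theorems

namespace Quant

namespace RootDec

open Finset

variable {κ : Type} [Fintype κ] [DecidableEq κ]

/-- product-Bernoulli weight of the set `W` of open blobs (as in `…QuantRootReduction`) -/
local notation3 "wt[" g ", " W "]" => ∏ k, (if k ∈ (W : Finset κ) then (g : κ → ℝ) k else 1 - (g : κ → ℝ) k)

/-- the TERM tail `P(s + Σ_{k open} a k ≥ j+1)` (as in `…QuantRootReduction`) -/
local notation3 "TERM[" s ", " a ", " g ", " j "]" =>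
  ∑ W : Finset κ, wt[g, W] * (if (j : ℕ) + 1 ≤ (s : ℕ) + ∑ k ∈ W, (a : κ → ℕ) k then (1 : ℝ) else 0)

/-- **The matching row as a TERM rule.**  Gates in `[0,1]`, floor `1/2 ≤ x < 1`; a finset `L` of blobs (any gates) with a companion map
`c`, injective on `L`, `c ℓ ∉ L`, `x ≤ g (c ℓ)`, `a ℓ ≤ a (c ℓ)`, `x(1 − g (c ℓ))(1 − g ℓ) ≤ (1 − x)·g (c ℓ)·g ℓ`; every blob outside `L`
heavy; sizes totalling `2(j − s) + 1 ≤ Σ a` ⟹ `x ≤ TERM[s, a, g, j]`.  (`IndepBlob.tail_ge_of_matched_companions`.) [this work] -/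
theorem term_ge_of_matched_companions (s : ℕ) (a : κ → ℕ) (g : κ → ℝ) (j : ℕ) (x : ℝ) (hx : 1 / 2 ≤ x) (hx1 : x < 1)
    (hg : ∀ k, 0 ≤ g k ∧ g k ≤ 1) (L : Finset κ) (c : κ → κ) (hcL : ∀ ℓ ∈ L, c ℓ ∉ L)
    (hcinj : ∀ ℓ₁ ∈ L, ∀ ℓ₂ ∈ L, c ℓ₁ = c ℓ₂ → ℓ₁ = ℓ₂) (hcx : ∀ ℓ ∈ L, x ≤ g (c ℓ))
    (hsize : ∀ ℓ ∈ L, a ℓ ≤ a (c ℓ)) (hodds : ∀ ℓ ∈ L, x * (1 - g (c ℓ)) * (1 - g ℓ) ≤ (1 - x) * g (c ℓ) * g ℓ)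
    (hheavy : ∀ k, k ∉ L → x ≤ g k) (htot : 2 * (j - s) + 1 ≤ ∑ k, a k) :
    x ≤ TERM[s, a, g, j] := by
  by_cases hs : j + 1 ≤ s
  · rw [term_eq_one_of_sure s a g j hs]; exact hx1.le
  rw [term_shift s a g j (by omega)]
  exact IndepBlob.tail_ge_of_matched_companions g a x hx hx1 (fun k => (hg k).1) (fun k => (hg k).2) L c hcL hcinj hcx hsize
    hodds hheavy (j - s) htot

end RootDec

end Quant

end Summit.CriticalPhenomena.PercolationContinuityZ3.Theorems
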